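import Summits.HubbardSuperconductivity.HubbardSuperconductivity.Theorems.AnisotropyChordTransferFibre3GreenZeroRowForm
import Summits.HubbardSuperconductivity.HubbardSuperconductivity.Theorems.AnisotropyChordTransferFibre3GreenZeroTrapezoid
import Summits.HubbardSuperconductivity.HubbardSuperconductivity.Theorems.AnisotropyChordTransferFibre3FamilyAMonotone
import Mathlib.Analysis.Complex.ExponentialBounds

/-!
# Route `AnisotropyChord` / H0 rotor rung: row-wise bounds for the Bose (ring-correction) factors of the capacity row sum (family A, LEMMA A0 step 3a)

In the exact row form `G̃₀(0) = (1 − 1/L²)/12 + (1/L)Σ_{p=1}^{L−1}(1 + b_p)ψ₀(2πp/L)` (`…GreenZeroRowForm.Gres_zero_eq`,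
`b_p = 2/(e^{Lμ_p} − 1)`, `ψ₀ = psiRow 0`) the ring corrections `(1/L)Σ_p b_p ψ₀(2πp/L)` are exponentially small except for the
first rows.  This file bounds them for every `L ≥ 64`:
* `rowMu_reflect`, `psiRow_row_reflect`: the symmetry `p ↔ L − p`;
* `L_mul_rowMu_ge` (crude, Jordan + `arsinh y ≥ .8813y`): `Lμ_p ≥ 3.5·p` for `2p ≤ L`;
  `L_mul_rowMu_ge_sharp` (`sin x ≥ x − x³/6`, `arsinh y ≥ y − y³/6`): `Lμ_p ≥ 2πp(1 − (πp/L)²/3)` for `πp ≤ L`;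
* `psiRow_row_div_le` (`ψ₀(2πp/L)/L ≤ 1/(8p)`), `psiRow_row_div_le_sharp` (`≤ 1/(4πp(1 − (πp/L)²/6))`);
* `bose_le_of` (monotonicity of the Bose factor) and the numerical constants `e^6 ≥ 400`, `e^{25/4} ≥ 500`, `e^{12} ≥ 160000`, `e^{−7/2} ≤ 1/30`;
  the per-row bounds and the sum `≤ 7·10⁻⁴` are assembled in `…GreenZeroBose`.
Prover seat `hubbard-h0-rotor-p1` g26; helper for stmt-HubbardSuperconductivity-19089 (`--supports`, helper class).
WHAT THIS IS NOT: nothing here proves superconductivity in the Hubbard model; an input lemma of ONE conditional reduction (rung 19089).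
Tree imports + `Mathlib.Analysis.Complex.ExponentialBounds`; no new definitions; no sorry, no axioms.
-/

set_option linter.dupNamespace false
set_option autoImplicit false

noncomputable section

open scoped BigOperators
open Real Finset

namespace Summit.HubbardSuperconductivity.HubbardSuperconductivity.Theorems.AnisotropyChord.Transfer.Fibre3

namespace CapacityConst

variable (L : ℕ) [NeZero L]

/-! ## Reflection `p ↔ L − p` -/

/-- `μ_{L−p} = μ_p`. [folklore] -/
theorem rowMu_reflect (p : ℕ) (hp : p ≤ L) : RateLemma.rowMu L (L - p) = RateLemma.rowMu L p := by
  have hLr : (L : ℝ) ≠ 0 := by exact_mod_cast NeZero.ne L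
  rw [RateLemma.rowMu_eq_arcosh, RateLemma.rowMu_eq_arcosh, Nat.cast_sub hp,
    show 2 * Real.pi * ((L : ℝ) - p) / L = 2 * Real.pi - 2 * Real.pi * p / L by field_simp,
    Real.cos_two_pi_sub]

/-- `ψ₀(2π(L−p)/L) = ψ₀(2πp/L)`. [folklore] -/
theorem psiRow_row_reflect (p : ℕ) (hp : p ≤ L) :
    psiRow 0 (2 * Real.pi * ((L - p : ℕ) : ℝ) / L) = psiRow 0 (2 * Real.pi * p / L) := by
  have hLr : (L : ℝ) ≠ 0 := by exact_mod_cast NeZero.ne L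
  rw [Nat.cast_sub hp, show 2 * Real.pi * ((L : ℝ) - p) / L = 2 * Real.pi - 2 * Real.pi * p / L by field_simp]
  exact psiRow_zero_reflect _

/-! ## Lower bounds on `L·μ_p` -/

omit [NeZero L] in
/-- crude: `L·μ_p ≥ 3.5·p` for `0 < p`, `2p ≤ L` (Jordan `sin x ≥ 2x/π` and `arsinh y ≥ 0.8813 y` on `[0,1]`). [folklore] -/
theorem L_mul_rowMu_ge (p : ℕ) (hp : 0 < p) (h2 : 2 * p ≤ L) :
    (7 / 2 : ℝ) * p ≤ L * RateLemma.rowMu L p := by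
  have hL0 : (0 : ℝ) < L := by exact_mod_cast (show 0 < L by omega)
  have hpL : p ≤ L := by omega
  rw [rowMu_eq_two_arsinh L p hpL]
  set x := Real.pi * p / L with hx
  have hx0 : 0 ≤ x := by positivity
  have hxle : x ≤ Real.pi / 2 := by
    rw [hx, div_le_div_iff₀ hL0 (by norm_num)]
    have : (2 * p : ℝ) ≤ L := by exact_mod_cast h2
    nlinarith [Real.pi_pos]
  have hJ := monotoneBrackets_holds.2.2.2.2 x hx0 hxle      -- 2x/π ≤ sin x
  have hs1 : Real.sin x ≤ 1 := Real.sin_le_one x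
  have hs0 : 0 ≤ Real.sin x := by
    have : 2 * x / Real.pi ≥ 0 := by positivity
    linarith
  have hA := monotoneBrackets_holds.2.1 (Real.sin x) hs0 hs1   -- 0.8813 sin x ≤ arsinh (sin x)
  have hJ' : 2 * (p : ℝ) / L ≤ Real.sin x := by
    have e : 2 * x / Real.pi = 2 * (p : ℝ) / L := by rw [hx]; field_simp
    linarith [e]
  have : (7 / 2 : ℝ) * p ≤ L * (2 * (0.8813 * (2 * (p : ℝ) / L))) := by
    rw [show (L : ℝ) * (2 * (0.8813 * (2 * (p : ℝ) / L))) = 3.5252 * p by field_simp; ring]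
    have : (0 : ℝ) < p := by exact_mod_cast hp
    nlinarith
  calc (7 / 2 : ℝ) * p ≤ L * (2 * (0.8813 * (2 * (p : ℝ) / L))) := this
    _ ≤ L * (2 * Real.arsinh (Real.sin x)) := by
        apply mul_le_mul_of_nonneg_left _ hL0.le
        nlinarith

/-- sharp: `L·μ_p ≥ 2πp(1 − (πp/L)²/3)` for `0 < p`, `πp ≤ L` (`sin x ≥ x − x³/6`, `arsinh y ≥ y − y³/6`). [folklore] -/
theorem L_mul_rowMu_ge_sharp (p : ℕ) (hp : 0 < p) (hxL : Real.pi * p ≤ L) :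
    2 * Real.pi * p * (1 - (Real.pi * p / L) ^ 2 / 3) ≤ L * RateLemma.rowMu L p := by
  have hL0 : (0 : ℝ) < L := by exact_mod_cast Nat.pos_of_ne_zero (NeZero.ne L)
  have hpL : p ≤ L := by
    have : (p : ℝ) ≤ L := by nlinarith [Real.pi_gt_three]
    exact_mod_cast this
  rw [rowMu_eq_two_arsinh L p hpL]
  set x := Real.pi * p / L with hx
  have hp0 : (0 : ℝ) < p := by exact_mod_cast hp
  have hx0 : 0 < x := by positivity
  have hx1 : x ≤ 1 := by rw [hx, div_le_one hL0]; exact hxL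
  have hslo : x - x ^ 3 / 6 < Real.sin x := Real.sin_gt_sub_cube hx0
  have hshi : Real.sin x ≤ x := Real.sin_le hx0.le
  have hx3 : x ^ 3 ≤ x := by
    have := pow_le_pow_of_le_one hx0.le hx1 (show 1 ≤ 3 by norm_num)
    simpa using this
  have hs0 : 0 ≤ Real.sin x := by linarith
  have hA := (monotoneBrackets_holds.1 (Real.sin x) hs0).1   -- sin x − sin³x/6 ≤ arsinh (sin x)
  have hcube : Real.sin x ^ 3 ≤ x ^ 3 := by
    exact pow_le_pow_left₀ hs0 hshi 3
  have hkey : x - x ^ 3 / 3 ≤ Real.arsinh (Real.sin x) := by nlinarith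
  have e : 2 * Real.pi * p * (1 - (Real.pi * p / L) ^ 2 / 3) = L * (2 * (x - x ^ 3 / 3)) := by
    rw [hx]; field_simp
  rw [e]
  exact mul_le_mul_of_nonneg_left (by linarith) hL0.le

/-! ## The Bose factor and `ψ₀/L` -/

omit [NeZero L] in
/-- monotonicity: `t ≤ Lμ_p`, `0 < t` ⇒ `b_p ≤ 2/(e^t − 1)`. [folklore] -/
theorem bose_le_of (p : ℕ) {t : ℝ} (ht : 0 < t) (h : t ≤ L * RateLemma.rowMu L p) :
    2 / (Real.exp (L * RateLemma.rowMu L p) - 1) ≤ 2 / (Real.exp t - 1) := by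
  have h1 : 1 < Real.exp t := Real.one_lt_exp_iff.mpr ht
  apply div_le_div_of_nonneg_left (by norm_num) (by linarith)
  linarith [Real.exp_le_exp.mpr h]

omit [NeZero L] in
/-- crude: `ψ₀(2πp/L)/L ≤ 1/(8p)` for `0 < p`, `2p ≤ L`. [folklore] -/
theorem psiRow_row_div_le (p : ℕ) (hp : 0 < p) (h2 : 2 * p ≤ L) :
    psiRow 0 (2 * Real.pi * p / L) / L ≤ 1 / (8 * p) := by
  have hL0 : (0 : ℝ) < L := by exact_mod_cast (show 0 < L by omega)
  have hpL : p < L := by omega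
  have hs := sin_row_pos L p hp hpL
  set s := Real.sin (Real.pi * p / L) with hsdef
  have hψ := psiRow_zero_eq (2 * Real.pi * p / L)
    (by rw [show 2 * Real.pi * (p : ℝ) / L / 2 = Real.pi * p / L by ring]; exact hs.le)
  rw [show 2 * Real.pi * (p : ℝ) / L / 2 = Real.pi * p / L by ring, ← hsdef] at hψ
  rw [hψ]
  have hxle : Real.pi * p / L ≤ Real.pi / 2 := by
    rw [div_le_div_iff₀ hL0 (by norm_num)]
    have : (2 * p : ℝ) ≤ L := by exact_mod_cast h2
    nlinarith [Real.pi_pos]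
  have hJ := monotoneBrackets_holds.2.2.2.2 (Real.pi * p / L) (by positivity) hxle
  have hJ' : 2 * (p : ℝ) / L ≤ s := by
    have e : 2 * (Real.pi * p / L) / Real.pi = 2 * (p : ℝ) / L := by field_simp
    rw [hsdef]; linarith [e]
  have hsq : 1 ≤ Real.sqrt (1 + s ^ 2) := by
    conv_lhs => rw [← Real.sqrt_one]
    exact Real.sqrt_le_sqrt (by nlinarith)
  have hp0 : (0 : ℝ) < p := by exact_mod_cast hp
  rw [div_div, div_le_div_iff₀ (by positivity) (by positivity)]
  have : 8 * (p : ℝ) ≤ 4 * s * Real.sqrt (1 + s ^ 2) * L := by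
    have h1 : 8 * (p : ℝ) ≤ 4 * s * L := by
      have := mul_le_mul_of_nonneg_left hJ' (show (0 : ℝ) ≤ 4 * L by positivity)
      rw [show 4 * (L : ℝ) * (2 * p / L) = 8 * p by field_simp; ring] at this
      linarith
    nlinarith [mul_le_mul_of_nonneg_left hsq (show (0 : ℝ) ≤ 4 * s * L by positivity)]
  linarith

/-- sharp: `ψ₀(2πp/L)/L ≤ 1/(4πp(1 − (πp/L)²/6))` for `0 < p`, `πp ≤ L`. [folklore] -/
theorem psiRow_row_div_le_sharp (p : ℕ) (hp : 0 < p) (hxL : Real.pi * p ≤ L) :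
    psiRow 0 (2 * Real.pi * p / L) / L ≤ 1 / (4 * Real.pi * p * (1 - (Real.pi * p / L) ^ 2 / 6)) := by
  have hL0 : (0 : ℝ) < L := by exact_mod_cast Nat.pos_of_ne_zero (NeZero.ne L)
  have hp0 : (0 : ℝ) < p := by exact_mod_cast hp
  have hpL : p < L := by
    have : (p : ℝ) < L := by nlinarith [Real.pi_gt_three]
    exact_mod_cast this
  have hs := sin_row_pos L p hp hpL
  set x := Real.pi * p / L with hx
  have hx0 : 0 < x := by positivity
  have hx1 : x ≤ 1 := by rw [hx, div_le_one hL0]; exact hxL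
  set s := Real.sin x with hsdef
  have hψ := psiRow_zero_eq (2 * Real.pi * p / L)
    (by rw [show 2 * Real.pi * (p : ℝ) / L / 2 = x by rw [hx]; ring]; exact hs.le)
  rw [show 2 * Real.pi * (p : ℝ) / L / 2 = x by rw [hx]; ring, ← hsdef] at hψ
  rw [hψ]
  have hslo : x - x ^ 3 / 6 < s := Real.sin_gt_sub_cube hx0
  have hsq : 1 ≤ Real.sqrt (1 + s ^ 2) := by
    conv_lhs => rw [← Real.sqrt_one]
    exact Real.sqrt_le_sqrt (by nlinarith)
  have hden : 0 < 4 * Real.pi * p * (1 - (Real.pi * p / L) ^ 2 / 6) := by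
    have : (Real.pi * p / L) ^ 2 ≤ 1 := by rw [← hx]; nlinarith
    have h6 : 0 < 1 - (Real.pi * p / L) ^ 2 / 6 := by linarith
    positivity
  rw [div_div, div_le_div_iff₀ (by positivity) hden]
  -- `4πp(1 − x²/6) = 4L(x − x³/6) ≤ 4 L s ≤ 4 s √(1+s²) L`
  have e : 4 * Real.pi * p * (1 - (Real.pi * p / L) ^ 2 / 6) = 4 * L * (x - x ^ 3 / 6) := by
    rw [hx]; field_simp
  rw [one_mul, e]
  have h1 : 4 * (L : ℝ) * (x - x ^ 3 / 6) ≤ 4 * L * s := by nlinarith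
  have h2 : 4 * (L : ℝ) * s ≤ 4 * s * Real.sqrt (1 + s ^ 2) * L := by
    nlinarith [mul_le_mul_of_nonneg_left hsq (show (0 : ℝ) ≤ 4 * s * L by positivity)]
  linarith

/-! ## Numerical constants -/

/-- `e^6 ≥ 400` (crude; enough here). [folklore] -/
theorem exp_six_ge_400 : (400 : ℝ) ≤ Real.exp 6 := by
  have h := Real.exp_one_gt_d9
  have : Real.exp 6 = Real.exp 1 ^ 6 := by rw [← Real.exp_nat_mul]; norm_num
  rw [this]
  have h0 : (0 : ℝ) ≤ 2.7182818283 := by norm_num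
  have := pow_le_pow_left₀ h0 h.le 6
  nlinarith

/-- `e^{25/4} ≥ 500`. [folklore] -/
theorem exp_quarter_ge : (500 : ℝ) ≤ Real.exp (25 / 4) := by
  have h1 := exp_six_ge_400
  have h2 : (1 / 4 : ℝ) + 1 ≤ Real.exp (1 / 4) := Real.add_one_le_exp _
  have : Real.exp (25 / 4) = Real.exp 6 * Real.exp (1 / 4) := by rw [← Real.exp_add]; norm_num
  rw [this]
  nlinarith [Real.exp_pos (1 / 4 : ℝ), Real.exp_pos (6 : ℝ)]

/-- `e^{12} ≥ 160000`. [folklore] -/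
theorem exp_twelve_ge : (160000 : ℝ) ≤ Real.exp 12 := by
  have h1 := exp_six_ge_400
  have : Real.exp 12 = Real.exp 6 * Real.exp 6 := by rw [← Real.exp_add]; norm_num
  rw [this]; nlinarith [Real.exp_pos (6 : ℝ)]

/-- `e^{-7/2} ≤ 1/30`. [folklore] -/
theorem exp_neg_ge : Real.exp (-(7 / 2 : ℝ)) ≤ 1 / 30 := by
  have h := Real.exp_one_gt_d9
  have h3 : Real.exp 3 = Real.exp 1 ^ 3 := by rw [← Real.exp_nat_mul]; norm_num
  have h30 : (30 : ℝ) ≤ Real.exp (7 / 2) := by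
    have : Real.exp (7 / 2) = Real.exp 3 * Real.exp (1 / 2) := by rw [← Real.exp_add]; norm_num
    rw [this, h3]
    have h2 : (1 / 2 : ℝ) + 1 ≤ Real.exp (1 / 2) := Real.add_one_le_exp _
    have h0 : (0 : ℝ) ≤ 2.7182818283 := by norm_num
    have := pow_le_pow_left₀ h0 h.le 3
    nlinarith [Real.exp_pos (1 / 2 : ℝ), pow_pos (Real.exp_pos (1 : ℝ)) 3]
  rw [Real.exp_neg, inv_eq_one_div, div_le_div_iff₀ (Real.exp_pos _) (by norm_num)]
  linarith

end CapacityConst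

end Summit.HubbardSuperconductivity.HubbardSuperconductivity.Theorems.AnisotropyChord.Transfer.Fibre3

end
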